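import Summits.Langlands.Langlands.Theses.CMFreeCompletedClosure
import Literature.Barriers.Langlands.MonodromyNotClosedUnderPadicLimits

/-!
# `TemperedPurity` (stmt-Langlands-18475): the monodromy step is false without global input

Negative lemma for the crux `CMFreeCompletedClosure.TemperedPurity` (C6 of route
`CMFreeCompletedClosure`). The crux upgrades, at every finite place `v`, "the complex Weil–Deligne
representation `rℂ = ι WD(ρ|_{E_v})` has the same characteristic polynomials on `W_{E_v}` as a
Frobenius-semisimple representative `r₀` of `rec(π_v)`" to "`rℂ^{F-ss}` has class `rec(π_v)`"
(`WeilDeligneRep.HasFrobSemisimpleClass`), i.e. it recovers the MONODROMY operator. This file shows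
that the purely local form of that step — with the global origin of `rℂ` (an irreducible `ρ`
Satake-compatible with a cuspidal `π`) dropped — is false at every non-archimedean local field in
rank `2`: the Steinberg-type parameter `St(1) = (‖·‖ ⊕ 1, N = E₀₁)` and the unramified
`St(0) = (‖·‖ ⊕ 1, N = 0)` (catalogued barrier `MonodromyNotClosedUnderPadicLimits`, `steinbergWD`)
have the same Weil-group action, hence the same characteristic polynomials, both are
Frobenius-semisimple, and they are not isomorphic. So any proof of the crux must use a global
input (purity / temperedness of `π_v`, as the route's mechanism says); the hypothesis "`ρ`
arises from a cuspidal `π`" is load-bearing. [folklore]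

## References
* J. Tate, *Number theoretic background*, Corvallis 1979, (4.1.4)–(4.1.5). [TateCorvallis1979]
* R. Taylor, T. Yoshida, *Compatibility of local and global Langlands correspondences*,
  J. Amer. Math. Soc. 20 (2007), Lemma 1.4 (purity pins `N`). [TaylorYoshida2007]
-/

noncomputable section

open scoped MatrixGroups Matrix
open Polynomial
open Literature.NumberTheory.Automorphic Literature.NumberTheory.GaloisRepresentations
open Literature.Barriers.Langlands

namespace Summit.Langlands.Langlands.Theorems.TemperedPurity.Negative

variable (F : Type*) [Field F] [ValuativeRel F] [TopologicalSpace F] [IsNonarchimedeanLocalField F]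

/-- A diagonal endomorphism of `ℂ^m` is semisimple (root of the separable `∏_{c ∈ S} (X - c)`,
`S` its set of entries). [folklore] -/
theorem isSemisimple_toLin'_diagonal {m : ℕ} (d : Fin m → ℂ) :
    Module.End.IsSemisimple (Matrix.toLin' (Matrix.diagonal d)) := by
  classical
  set S : Finset ℂ := Finset.univ.image d with hS
  refine Module.End.isSemisimple_of_squarefree_aeval_eq_zero (p := ∏ c ∈ S, (X - C c)) ?_ ?_
  · exact (Polynomial.separable_prod_X_sub_C_iff'.2 fun x _ y _ h => h).squarefree
  · have h1 : Matrix.toLin' (Matrix.diagonal d) =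
        Matrix.toLinAlgEquiv' (Matrix.diagonalAlgHom ℂ d) := rfl
    have h2 : aeval d (∏ c ∈ S, (X - C c)) = 0 := by
      funext i
      rw [aeval_pi_apply₂, map_prod]
      exact Finset.prod_eq_zero (Finset.mem_image_of_mem _ (Finset.mem_univ i)) (by simp)
    rw [h1, aeval_algHom_apply, aeval_algHom_apply, h2, map_zero, map_zero]

/-- Every `St(b) = (‖·‖ ⊕ 1, b·E₀₁)` is Frobenius-semisimple (its Weil-group action is diagonal).
[cite: TateCorvallis1979, (4.1.4)] -/
theorem isFrobSemisimple_steinbergWD (b : ℂ) : (steinbergWD F ℂ b).IsFrobSemisimple :=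
  fun w => isSemisimple_toLin'_diagonal (stDiag F ℂ (WeilGroup.deg w))

/-- A Frobenius-semisimplification of `St(0)` has `N = 0`, so it is not isomorphic to `St(1)`.
[cite: TateCorvallis1979, (4.1.5)] -/
theorem not_hasFrobSemisimpleClass_steinbergWD_zero_one :
    ¬ (steinbergWD F ℂ 0).HasFrobSemisimpleClass
      (Quotient.mk (frobSemisimpleWDSetoid F 2)
        ⟨steinbergWD F ℂ 1, isFrobSemisimple_steinbergWD F 1⟩) := by
  rintro ⟨r', hr', hcls⟩
  have hN' : r'.N = 0 := hr'.1.trans ((steinbergWD_N_eq_zero_iff F ℂ 0).2 rfl)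
  have heq : r'.IsEquivalent (steinbergWD F ℂ 1) := Quotient.exact hcls
  exact one_ne_zero ((steinbergWD_N_eq_zero_iff F ℂ 1).1 (heq.N_eq_zero hN'))

/-- **`TemperedPurity` is false without its global hypotheses** — the LOCAL form of its monodromy
step (the crux with the global origin of `rℂ` dropped: "for Weil–Deligne representations of `W_F`
on `ℂ²`, if `r₀` is Frobenius-semisimple and `rℂ`, `r₀` have the same characteristic polynomials on
the Weil group, then `rℂ^{F-ss}` has the class of `r₀`") fails over every non-archimedean local
field: witness `rℂ = St(0)`, `r₀ = St(1)` (same Weil-group action `‖·‖ ⊕ 1`, hence the same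
characteristic polynomials; `N = 0` versus `N ≠ 0`). Any proof of the crux must therefore use that
`rℂ` comes from an irreducible `ρ` attached to a CUSPIDAL `π` (purity/temperedness), exactly the
route's named mechanism. [folklore] -/
theorem temperedPurity_false_without_global :
    ¬ ∀ (rℂ r₀ : WeilDeligneRep F ℂ (Fin 2 → ℂ)) (h₀ : r₀.IsFrobSemisimple),
        (∀ w : WeilGroup F,
          (LinearMap.toMatrix' (rℂ.ρ w)).charpoly = (LinearMap.toMatrix' (r₀.ρ w)).charpoly) →
        rℂ.HasFrobSemisimpleClass (Quotient.mk (frobSemisimpleWDSetoid F 2) ⟨r₀, h₀⟩) :=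
  fun h => not_hasFrobSemisimpleClass_steinbergWD_zero_one F
    (h (steinbergWD F ℂ 0) (steinbergWD F ℂ 1) (isFrobSemisimple_steinbergWD F 1) fun _ => rfl)

end Summit.Langlands.Langlands.Theorems.TemperedPurity.Negative

end
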